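import Summits.CriticalPhenomena.PercolationContinuityZ3.Theorems.Transplant.GrigorchukPowerLazyKernel
import Summits.CriticalPhenomena.PercolationContinuityZ3.Theorems.Transplant.PSDTraceCubeMonotone
import Literature.Probability.Percolation.PercolationProofs
import Mathlib.MeasureTheory.Integral.Bochner.Set
import Literature.Probability.RandomPlanarGeometry.SAWBubbleBound
import HarnessLib

/-!
# W4 — ball matrices for `TraceMonotonicity` (item E4.3, file b): the two-point matrix `T_B = (τ_p(x,y))_{x,y∈B}` is positive semidefinite, the Green
# matrix `G_B = (Σ_n p^L_n(x,y))` dominates it under the operator infrared bound, `tr T_B³ ≤ C³ tr G_B³`, and the diagonal comparisons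

Proof file (`--supports stmt-CriticalPhenomena-4575 --as helper`), lane `prim-bschramm`, seat `prim-bschramm-gen-1` gen 12 (GEN pen); item E4.3 (lead g29 #9800, design
shape p3 g42 #9829, statements p5-g34 #9831), FILE b of three, over FILE a «GrigorchukPowerLazyKernel» (Chapman–Kolmogorov, symmetry, positivity of `P_L^n`), DEFS-A
(`conn`, `twoPointForm`, `greenForm`, `OperatorIRBound`, `rwPolygon`) and the finite shadow «PSDTraceCubeMonotone» (p686689, `TraceShadow.trace_pow_three_mono_real`).
builds on p205010 (kernel theorem, internal audit signed; external expert review pending) — nothing here uses p205010.  Def-free; no instance, no notation, no sorry,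
no `@[conjecture]`; nothing about `θ(p_c)`; generic over a locally finite (`d`-regular where said) graph and a finite vertex set `B`.

CONTENT.  §1 **`conn_quadratic_nonneg`**: `Σ_{x,y∈B} v(x) v(y) τ_p(x,y) ≥ 0` — for every configuration `ω`, `Σ v(x)v(y)𝟙{x ↔ y} = Σ_𝒞 (Σ_{x∈𝒞∩B} v)² ≥ 0` (an
equivalence-relation lemma `sum_mul_ite_equivalence_nonneg`, no quotients: `Σ_x S(x)²/n(x)`), then expectation; hence `posSemidef_connMatrix`.  §2 Green kernel in `ℝ≥0∞`:
**`green_cube_diag_le`**: `Σ_{y,z∈B} 𝒢(x,y)𝒢(y,z)𝒢(z,x) ≤ Σ_N C(N+2,2)·p^L_N(x,x)` (`𝒢 = Σ_n ofReal p^L_n`; Cauchy products + FILE a's restricted Chapman–Kolmogorov).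
§3 Under `Summable (n ↦ p^L_n(x,y))` for the pairs in `B` and `d`-regularity: the extension-by-zero test function `extFun B v : V →₀ ℝ`, `twoPointForm = vᵀ T_B v`,
**`greenForm_extFun_eq`**: `greenForm G (extFun B v) = ofReal (vᵀ G_B v)` (each `⟨v, P_L^n v⟩ ≥ 0` by FILE a — the `ofReal` clipping of DEFS-A is harmless),
**`posSemidef_green_sub_conn`**: `OperatorIRBound G (ofReal c)` and `p < p_c(G, v₀)` give `(c • G_B − T_B).PosSemidef`, and
**`trace_connMatrix_pow_three_le`**: `tr T_B³ ≤ c³ · tr G_B³` (p686689); §4 diagonals: `connMatrix_pow_three_diag` (`(T_B³)(x,x)` = the triangle diagram restricted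
to `B`), `greenMatrix_pow_three_diag_le` (`(G_B³)(x,x) ≤ G^L_3(x) = rwPolygon 3 G x` when finite; via §2 and `rwPolygon_three_eq`).  The `ℝ≥0∞` Cauchy product is
«SAWBubbleBound»'s `ennreal_tsum_mul_tsum_eq_tsum_sum_antidiagonal` (multiplication on `ℝ≥0∞` is not continuous, so Mathlib's ring version does not apply).
[cite: HeydenreichVanDerHofstad2017, §1.2 (infrared bound), §4.1 (triangle), §5.2] [cite: HornJohnson2013, Cor. 7.7.4] [cite: Woess2000, §1.B]
-/

noncomputable section

namespace Summit.CriticalPhenomena.PercolationContinuityZ3.Theorems.Transplant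

namespace Grigorchuk

namespace NcHaraSlade

open SimpleGraph Finset MeasureTheory Literature.Probability.Percolation
open scoped ENNReal

variable {V : Type} [DecidableEq V] (G : SimpleGraph V) [G.LocallyFinite]

/-! ## §1 The two-point matrix is positive semidefinite -/

omit [DecidableEq V] in
/-- **Quadratic forms of an equivalence relation are nonnegative**: `0 ≤ Σ_{x,y∈B} v(x) v(y) [x ∼ y]` for an equivalence relation `∼` — it equals
`Σ_{x∈B} S(x)²/n(x)` with `S(x) = Σ_{y∈B, y∼x} v(y)` and `n(x) = #{y ∈ B : y ∼ x} ≥ 1` (class functions).  The percolation instance: `x ↔ y` in a fixed configuration.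
(The finite-`V` Gram identity is «ConnectivityGramMatrix» `ConnGram.quadForm_eq_sum_sq`; here `B` is a finite window of an arbitrary vertex type.)
[cite: BarskyAizenman1991, Lemma 3.3] [cite: AizenmanNewman1984, Lemma 3.3 (Schwarz inequality for τ)] -/
theorem sum_mul_ite_equivalence_nonneg (B : Finset V) (v : V → ℝ) (r : V → V → Prop) [DecidableRel r] (hr : Equivalence r) :
    0 ≤ ∑ x ∈ B, ∑ y ∈ B, v x * v y * (if r x y then 1 else 0) := by
  -- class sums and class sizes (inside `B`)
  set S : V → ℝ := fun x => ∑ y ∈ B, (if r x y then v y else 0) with hS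
  set n : V → ℝ := fun x => (((B.filter fun y => r x y).card : ℕ) : ℝ) with hn
  have hcls : ∀ x y, r x y → S x = S y ∧ n x = n y := by
    intro x y hxy
    have hiff : ∀ z, r x z ↔ r y z := fun z => ⟨fun h => hr.trans (hr.symm hxy) h, fun h => hr.trans hxy h⟩
    constructor
    · exact Finset.sum_congr rfl fun z _ => by simp only [hiff z]
    · simp only [hn]
      rw [Finset.filter_congr fun z _ => hiff z]
  have hnpos : ∀ x ∈ B, 0 < n x := fun x hx => by
    simp only [hn]
    exact_mod_cast Finset.card_pos.2 ⟨x, Finset.mem_filter.2 ⟨hx, hr.refl x⟩⟩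
  -- `Q = Σ_x v(x) S(x)`
  have hQ : ∑ x ∈ B, ∑ y ∈ B, v x * v y * (if r x y then 1 else 0) = ∑ x ∈ B, v x * S x := by
    refine Finset.sum_congr rfl fun x _ => ?_
    rw [hS, Finset.mul_sum]
    exact Finset.sum_congr rfl fun y _ => by split_ifs <;> ring
  -- `Σ_x S(x)²/n(x) = Σ_x v(x) S(x)`
  have hkey : ∑ x ∈ B, S x ^ 2 / n x = ∑ x ∈ B, v x * S x := by
    calc ∑ x ∈ B, S x ^ 2 / n x = ∑ x ∈ B, ∑ y ∈ B, (if r x y then v y * (S x / n x) else 0) := by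
          refine Finset.sum_congr rfl fun x _ => ?_
          rw [sq, div_eq_mul_inv, mul_assoc, ← div_eq_mul_inv, hS, Finset.sum_mul]
          exact Finset.sum_congr rfl fun y _ => by split_ifs <;> ring
      _ = ∑ y ∈ B, ∑ x ∈ B, (if r x y then v y * (S x / n x) else 0) := Finset.sum_comm
      _ = ∑ y ∈ B, ∑ x ∈ B, (if r y x then v y * (S y / n y) else 0) := by
          refine Finset.sum_congr rfl fun y _ => Finset.sum_congr rfl fun x _ => ?_
          by_cases h : r x y
          · obtain ⟨hSe, hne⟩ := hcls x y h
            rw [if_pos h, if_pos (hr.symm h), hSe, hne]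
          · rw [if_neg h, if_neg (fun h' => h (hr.symm h'))]
      _ = ∑ y ∈ B, v y * S y := by
          refine Finset.sum_congr rfl fun y hy => ?_
          rw [← Finset.sum_filter, Finset.sum_const, nsmul_eq_mul]
          have : (((B.filter fun x => r y x).card : ℕ) : ℝ) = n y := rfl
          rw [this]
          field_simp [(hnpos y hy).ne']
  rw [hQ, ← hkey]
  exact Finset.sum_nonneg fun x hx => div_nonneg (sq_nonneg _) (hnpos x hx).le

omit [DecidableEq V] [G.LocallyFinite] in
/-- **`Σ_{x,y∈B} v(x) v(y) τ_p(x, y) ≥ 0`** — the two-point function is a positive semidefinite kernel: `τ_p(x,y) = E[𝟙{x ↔ y}]` and, configuration by configuration,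
`Σ v(x)v(y)𝟙{x ↔ y} = Σ_𝒞 (Σ_{x∈𝒞∩B} v(x))² ≥ 0` (`sum_mul_ite_equivalence_nonneg` for the open-cluster relation).  Finite-`V` version:
«ConnectivityGramMatrix» `posSemidef_connKernelMatrix`; here for a finite window `B` of an infinite graph (paths may leave `B`).
[cite: BarskyAizenman1991, Lemma 3.3] [cite: HeydenreichVanDerHofstad2017, §1.2 (the two-point function as a positive operator)] -/
theorem conn_quadratic_nonneg [Countable V] (p : unitInterval) (B : Finset V) (v : V → ℝ) :
    0 ≤ ∑ x ∈ B, ∑ y ∈ B, v x * v y * conn G p x y := by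
  classical
  set μ := bondPercolation G p with hμ
  have hmeas : ∀ x y : V, MeasurableSet (openConn x y : Set (BondConfig V)) := fun x y => measurableSet_openConn_holds x y
  -- `τ(x,y) = ∫ 𝟙{x ↔ y}`
  have hconn : ∀ x y : V, conn G p x y = ∫ ω, (openConn x y : Set (BondConfig V)).indicator (1 : BondConfig V → ℝ) ω ∂μ := by
    intro x y
    rw [integral_indicator_one (hmeas x y)]
    rfl
  have hint : ∀ x y : V, Integrable (fun ω => (openConn x y : Set (BondConfig V)).indicator (1 : BondConfig V → ℝ) ω) μ :=
    fun x y => (integrable_const (1 : ℝ)).indicator (hmeas x y)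
  -- exchange the finite sums and the integral
  have hswap : ∑ x ∈ B, ∑ y ∈ B, v x * v y * conn G p x y =
      ∫ ω, ∑ x ∈ B, ∑ y ∈ B, v x * v y * (openConn x y : Set (BondConfig V)).indicator (1 : BondConfig V → ℝ) ω ∂μ := by
    rw [integral_finsetSum _ fun x _ => integrable_finsetSum _ fun y _ => (hint x y).const_mul _]
    refine Finset.sum_congr rfl fun x _ => ?_
    rw [integral_finsetSum _ fun y _ => (hint x y).const_mul _]
    refine Finset.sum_congr rfl fun y _ => ?_
    rw [integral_const_mul, hconn]
  rw [hswap]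
  refine integral_nonneg fun ω => ?_
  -- pointwise: the open-cluster relation of `ω` is an equivalence relation
  have hr : Equivalence fun x y : V => (openGraph ω).Reachable x y :=
    ⟨fun x => Reachable.refl x, fun h => h.symm, fun h₁ h₂ => h₁.trans h₂⟩
  have h := sum_mul_ite_equivalence_nonneg B v (fun x y : V => (openGraph ω).Reachable x y) hr
  refine h.trans (le_of_eq (Finset.sum_congr rfl fun x _ => Finset.sum_congr rfl fun y _ => ?_))
  congr 1

omit [G.LocallyFinite] in
/-- **The two-point matrix of a finite vertex set is positive semidefinite**: `(τ_p(x, y))_{x,y∈B} ⪰ 0` (symmetric by `conn_comm`, nonnegative quadratic forms by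
`conn_quadratic_nonneg`). [cite: BarskyAizenman1991, Lemma 3.3] [cite: HeydenreichVanDerHofstad2017, §1.2] -/
theorem posSemidef_connMatrix [Countable V] (p : unitInterval) (B : Finset V) :
    (Matrix.of fun x y : ↥B => conn G p (x : V) (y : V)).PosSemidef := by
  rw [Matrix.posSemidef_iff_dotProduct_mulVec]
  refine ⟨Matrix.IsHermitian.ext fun x y => by simp only [Matrix.of_apply, star_trivial, conn_comm], fun w => ?_⟩
  -- `wᵀ T_B w = Σ_{x,y∈B} w x w y τ(x,y)` for `w : B → ℝ`, extended by zero
  have h := conn_quadratic_nonneg G p B (fun x => if hx : x ∈ B then w ⟨x, hx⟩ else 0)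
  simp only [star_trivial, dotProduct, Matrix.mulVec, Matrix.of_apply]
  refine h.trans (le_of_eq ?_)
  rw [← Finset.sum_attach B]
  simp only [Finset.univ_eq_attach]
  refine Finset.sum_congr rfl fun x _ => ?_
  rw [← Finset.sum_attach B, Finset.mul_sum]
  refine Finset.sum_congr rfl fun y _ => ?_
  simp only [Finset.coe_mem, dite_true, Subtype.coe_eta]
  ring

/-! ## §2 The Green kernel's cube in `ℝ≥0∞` -/

/-- **`Σ_{y,z∈B} 𝒢(x,y)·𝒢(y,z)·𝒢(z,x) ≤ Σ_N C(N+2, 2)·p^L_N(x, x)`** in `ℝ≥0∞`, with `𝒢(x,y) = Σ_n ofReal p^L_n(x,y)`: expand the three series (Cauchy products via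
the antidiagonal), restrict the middle points to `B` (FILE a `sum_lazyStep_mul_le`), and count `#{(a,b) : a + b = M} = M+1`, `Σ_{M ≤ N} (M+1) = C(N+2, 2)`.
[cite: HeydenreichVanDerHofstad2017, §5.2 (random-walk diagrams)] [cite: Woess2000, §1.B] -/
theorem green_cube_diag_le (B : Finset V) (x : V) :
    ∑ y ∈ B, ∑ z ∈ B, (∑' a : ℕ, ENNReal.ofReal (lazyStep G a x y)) * (∑' b : ℕ, ENNReal.ofReal (lazyStep G b y z)) *
        (∑' c : ℕ, ENNReal.ofReal (lazyStep G c z x)) ≤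
      ∑' N : ℕ, (((N + 2).choose 2 : ℕ) : ℝ≥0∞) * ENNReal.ofReal (lazyStep G N x x) := by
  -- step 1: `Σ_{y∈B} 𝒢(x,y) ofReal(p_b(y,z)) ≤ Σ_M ...`: two-factor Cauchy product with the middle point restricted
  have hpair : ∀ u y w : V, (∑' a : ℕ, ENNReal.ofReal (lazyStep G a u y)) * (∑' b : ℕ, ENNReal.ofReal (lazyStep G b y w)) =
      ∑' M : ℕ, ∑ ab ∈ antidiagonal M, ENNReal.ofReal (lazyStep G ab.1 u y) * ENNReal.ofReal (lazyStep G ab.2 y w) :=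
    fun u y w => Literature.Probability.RandomPlanarGeometry.SAW.Zd.ennreal_tsum_mul_tsum_eq_tsum_sum_antidiagonal _ _
  -- H(x,z) := Σ_{y∈B} 𝒢(x,y)𝒢(y,z) ≤ Σ_M (M+1) ofReal(p_M(x,z))
  have hH : ∀ z : V, ∑ y ∈ B, (∑' a : ℕ, ENNReal.ofReal (lazyStep G a x y)) * (∑' b : ℕ, ENNReal.ofReal (lazyStep G b y z)) ≤
      ∑' M : ℕ, ((M + 1 : ℕ) : ℝ≥0∞) * ENNReal.ofReal (lazyStep G M x z) := by
    intro z
    calc ∑ y ∈ B, (∑' a : ℕ, ENNReal.ofReal (lazyStep G a x y)) * (∑' b : ℕ, ENNReal.ofReal (lazyStep G b y z))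
        = ∑ y ∈ B, ∑' M : ℕ, ∑ ab ∈ antidiagonal M, ENNReal.ofReal (lazyStep G ab.1 x y) * ENNReal.ofReal (lazyStep G ab.2 y z) :=
          Finset.sum_congr rfl fun y _ => hpair x y z
      _ = ∑' M : ℕ, ∑ ab ∈ antidiagonal M, ∑ y ∈ B, ENNReal.ofReal (lazyStep G ab.1 x y * lazyStep G ab.2 y z) := by
          rw [← Summable.tsum_finsetSum (fun _ _ => ENNReal.summable)]
          refine tsum_congr fun M => ?_
          rw [Finset.sum_comm]
          refine Finset.sum_congr rfl fun ab _ => Finset.sum_congr rfl fun y _ => ?_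
          rw [ENNReal.ofReal_mul (lazyStep_nonneg G _ _ _)]
      _ ≤ ∑' M : ℕ, ∑ ab ∈ antidiagonal M, ENNReal.ofReal (lazyStep G M x z) := by
          refine ENNReal.tsum_le_tsum fun M => Finset.sum_le_sum fun ab hab => ?_
          rw [← ENNReal.ofReal_sum_of_nonneg (fun y _ => mul_nonneg (lazyStep_nonneg G _ _ _) (lazyStep_nonneg G _ _ _))]
          refine ENNReal.ofReal_le_ofReal ?_
          have h := sum_lazyStep_mul_le G ab.1 ab.2 x z B
          rwa [Finset.HasAntidiagonal.mem_antidiagonal.1 hab] at h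
      _ = ∑' M : ℕ, ((M + 1 : ℕ) : ℝ≥0∞) * ENNReal.ofReal (lazyStep G M x z) := by
          refine tsum_congr fun M => ?_
          rw [Finset.sum_const, Finset.Nat.card_antidiagonal, nsmul_eq_mul]
  -- step 2: multiply by 𝒢(z,x), sum over `z ∈ B`, Cauchy product again, restrict `z`
  calc ∑ y ∈ B, ∑ z ∈ B, (∑' a : ℕ, ENNReal.ofReal (lazyStep G a x y)) * (∑' b : ℕ, ENNReal.ofReal (lazyStep G b y z)) *
        (∑' c : ℕ, ENNReal.ofReal (lazyStep G c z x))
      = ∑ z ∈ B, (∑ y ∈ B, (∑' a : ℕ, ENNReal.ofReal (lazyStep G a x y)) * (∑' b : ℕ, ENNReal.ofReal (lazyStep G b y z))) *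
          (∑' c : ℕ, ENNReal.ofReal (lazyStep G c z x)) := by
        rw [Finset.sum_comm]
        exact Finset.sum_congr rfl fun z _ => by rw [Finset.sum_mul]
    _ ≤ ∑ z ∈ B, (∑' M : ℕ, ((M + 1 : ℕ) : ℝ≥0∞) * ENNReal.ofReal (lazyStep G M x z)) * (∑' c : ℕ, ENNReal.ofReal (lazyStep G c z x)) :=
        Finset.sum_le_sum fun z _ => mul_le_mul' (hH z) le_rfl
    _ = ∑ z ∈ B, ∑' N : ℕ, ∑ Mc ∈ antidiagonal N,
          ((Mc.1 + 1 : ℕ) : ℝ≥0∞) * ENNReal.ofReal (lazyStep G Mc.1 x z) * ENNReal.ofReal (lazyStep G Mc.2 z x) :=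
        Finset.sum_congr rfl fun z _ => by
          rw [Literature.Probability.RandomPlanarGeometry.SAW.Zd.ennreal_tsum_mul_tsum_eq_tsum_sum_antidiagonal]
    _ = ∑' N : ℕ, ∑ Mc ∈ antidiagonal N, ((Mc.1 + 1 : ℕ) : ℝ≥0∞) *
          ∑ z ∈ B, ENNReal.ofReal (lazyStep G Mc.1 x z * lazyStep G Mc.2 z x) := by
        rw [← Summable.tsum_finsetSum (fun _ _ => ENNReal.summable)]
        refine tsum_congr fun N => ?_
        rw [Finset.sum_comm]
        refine Finset.sum_congr rfl fun Mc _ => ?_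
        rw [Finset.mul_sum]
        refine Finset.sum_congr rfl fun z _ => ?_
        rw [ENNReal.ofReal_mul (lazyStep_nonneg G _ _ _), mul_assoc]
    _ ≤ ∑' N : ℕ, ∑ Mc ∈ antidiagonal N, ((Mc.1 + 1 : ℕ) : ℝ≥0∞) * ENNReal.ofReal (lazyStep G N x x) := by
        refine ENNReal.tsum_le_tsum fun N => Finset.sum_le_sum fun Mc hMc => mul_le_mul' le_rfl ?_
        rw [← ENNReal.ofReal_sum_of_nonneg (fun z _ => mul_nonneg (lazyStep_nonneg G _ _ _) (lazyStep_nonneg G _ _ _))]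
        refine ENNReal.ofReal_le_ofReal ?_
        have h := sum_lazyStep_mul_le G Mc.1 Mc.2 x x B
        rwa [Finset.HasAntidiagonal.mem_antidiagonal.1 hMc] at h
    _ = ∑' N : ℕ, (((N + 2).choose 2 : ℕ) : ℝ≥0∞) * ENNReal.ofReal (lazyStep G N x x) := by
        refine tsum_congr fun N => ?_
        rw [← Finset.sum_mul]
        congr 1
        -- `Σ_{(M,c) : M + c = N} (M+1) = C(N+2, 2)`
        have hnat : ∑ M ∈ Finset.range (N + 1), (M + 1) = (N + 2).choose 2 := by
          induction N with
          | zero => simp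
          | succ N ih =>
            rw [Finset.sum_range_succ, ih, show N + 1 + 2 = (N + 2) + 1 by ring, Nat.choose_succ_succ (N + 2) 1, Nat.choose_one_right]
            ring
        rw [Finset.Nat.sum_antidiagonal_eq_sum_range_succ (fun i _ => ((i + 1 : ℕ) : ℝ≥0∞)) N, ← Nat.cast_sum, hnat]

omit [DecidableEq V] in
/-- `G^L_3(x) = Σ_N C(N+2, 2)·ofReal p^L_N(x, x)` — DEFS-A's `rwPolygon 3`, with the binomial weight pulled out of `ofReal`. -/
theorem rwPolygon_three_eq (x : V) :
    rwPolygon 3 G x = ∑' N : ℕ, (((N + 2).choose 2 : ℕ) : ℝ≥0∞) * ENNReal.ofReal (lazyStep G N x x) := by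
  unfold rwPolygon
  refine tsum_congr fun N => ?_
  rw [show N + 3 - 1 = N + 2 by omega, show 3 - 1 = 2 by norm_num, ENNReal.ofReal_mul (Nat.cast_nonneg _), ENNReal.ofReal_natCast]

/-! ## §3 The Green matrix dominates the two-point matrix under the operator infrared bound -/

omit [G.LocallyFinite] in
/-- The quadratic form of a kernel `K` at the extension by zero of `w : B → ℝ` is `wᵀ (K|_B) w`. -/
theorem sum_ext_mul_eq_dotProduct (B : Finset V) (K : V → V → ℝ) (w : ↥B → ℝ) :
    ∑ x ∈ B, ∑ y ∈ B, (if hx : x ∈ B then w ⟨x, hx⟩ else 0) * (if hy : y ∈ B then w ⟨y, hy⟩ else 0) * K x y =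
      w ⬝ᵥ (Matrix.of fun x y : ↥B => K x y).mulVec w := by
  simp only [dotProduct, Matrix.mulVec, Matrix.of_apply]
  rw [← Finset.sum_attach B]
  simp only [Finset.univ_eq_attach]
  refine Finset.sum_congr rfl fun x _ => ?_
  rw [← Finset.sum_attach B, Finset.mul_sum]
  refine Finset.sum_congr rfl fun y _ => ?_
  simp only [Finset.coe_mem, dite_true, Subtype.coe_eta]
  ring

omit [DecidableEq V] [G.LocallyFinite] in
/-- A quadratic form over `f.support` is the same form over any `B ⊇ f.support`. -/
theorem sum_support_eq_sum (f : V →₀ ℝ) {B : Finset V} (hB : f.support ⊆ B) (K : V → V → ℝ) :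
    ∑ x ∈ f.support, ∑ y ∈ f.support, f x * f y * K x y = ∑ x ∈ B, ∑ y ∈ B, f x * f y * K x y := by
  rw [Finset.sum_subset hB fun x _ hx => by simp [Finsupp.notMem_support_iff.1 hx]]
  exact Finset.sum_congr rfl fun x _ => Finset.sum_subset hB fun y _ hy => by simp [Finsupp.notMem_support_iff.1 hy]

omit [DecidableEq V] in
/-- **`Σ_{x,y∈B} v(x)v(y) 𝒢_L(x,y) = Σ_n ⟨v, P_L^n v⟩_B`** when every `n ↦ p^L_n(x, y)` is summable (`𝒢_L(x,y) = Σ_n p^L_n(x,y)` in `ℝ`). -/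
theorem green_quadratic_eq_tsum (hsum : ∀ x y : V, Summable fun n => lazyStep G n x y) (B : Finset V) (v : V → ℝ) :
    ∑ x ∈ B, ∑ y ∈ B, v x * v y * ∑' n, lazyStep G n x y = ∑' n, ∑ x ∈ B, ∑ y ∈ B, v x * v y * lazyStep G n x y := by
  have hs : ∀ x y, Summable fun n => v x * v y * lazyStep G n x y := fun x y => (hsum x y).mul_left _
  rw [Summable.tsum_finsetSum (fun x _ => summable_sum fun y _ => hs x y)]
  refine Finset.sum_congr rfl fun x _ => ?_
  rw [Summable.tsum_finsetSum (fun y _ => hs x y)]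
  refine Finset.sum_congr rfl fun y _ => ?_
  exact tsum_mul_left.symm

/-- **`Σ_{x,y∈B} v(x)v(y) 𝒢_L(x,y) ≥ 0`** on a `d`-regular graph (each `⟨v, P_L^n v⟩ ≥ 0`, FILE a). -/
theorem green_quadratic_nonneg {d : ℕ} (hG : G.IsRegularOfDegree d) (hsum : ∀ x y : V, Summable fun n => lazyStep G n x y)
    (B : Finset V) (v : V → ℝ) : 0 ≤ ∑ x ∈ B, ∑ y ∈ B, v x * v y * ∑' n, lazyStep G n x y := by
  rw [green_quadratic_eq_tsum G hsum]
  exact tsum_nonneg fun n => lazyStep_quadratic_nonneg G hG n B v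

/-- **`greenForm G f = ofReal (Σ_{x,y∈B} f(x)f(y) 𝒢_L(x,y))`** for `f` supported in `B`, on a `d`-regular graph with summable `n ↦ p^L_n(x,y)`: the `ofReal`
clipping in DEFS-A's `greenForm` is harmless because every `⟨f, P_L^n f⟩ ≥ 0` (FILE a `lazyStep_quadratic_nonneg`). -/
theorem greenForm_eq_ofReal {d : ℕ} (hG : G.IsRegularOfDegree d) (hsum : ∀ x y : V, Summable fun n => lazyStep G n x y)
    (f : V →₀ ℝ) {B : Finset V} (hB : f.support ⊆ B) :
    greenForm G f = ENNReal.ofReal (∑ x ∈ B, ∑ y ∈ B, f x * f y * ∑' n, lazyStep G n x y) := by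
  unfold greenForm
  have hq : ∀ n, ∑ x ∈ f.support, ∑ y ∈ f.support, f x * f y * lazyStep G n x y = ∑ x ∈ B, ∑ y ∈ B, f x * f y * lazyStep G n x y :=
    fun n => sum_support_eq_sum f hB _
  simp only [hq]
  have hs : ∀ x y, Summable fun n => f x * f y * lazyStep G n x y := fun x y => (hsum x y).mul_left _
  rw [green_quadratic_eq_tsum G hsum,
    ENNReal.ofReal_tsum_of_nonneg (fun n => lazyStep_quadratic_nonneg G hG n B f) (summable_sum fun x _ => summable_sum fun y _ => hs x y)]

/-- **`(c·G_B − T_B) ⪰ 0`**: under the operator infrared bound `OIRB_{ofReal c}(G)` and `p < p_c(G, v₀)`, for every finite `B` the matrix `c·(𝒢_L(x,y))_{x,y∈B} −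
(τ_p(x,y))_{x,y∈B}` is positive semidefinite — test `OIRB` on the extension by zero of `w : B → ℝ` and use `greenForm_eq_ofReal`. (`d`-regular graph, summable
`n ↦ p^L_n(x,y)`; `Countable V` for the percolation measure.) [cite: HeydenreichVanDerHofstad2017, §1.2 (infrared bound)] -/
theorem posSemidef_green_sub_conn [Countable V] {d : ℕ} (hG : G.IsRegularOfDegree d) (hsum : ∀ x y : V, Summable fun n => lazyStep G n x y)
    {c : ℝ} (hc : 0 ≤ c) (hO : OperatorIRBound G (ENNReal.ofReal c)) {p : unitInterval} {v₀ : V} (hp : (p : ℝ) < criticalProb G v₀) (B : Finset V) :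
    (c • Matrix.of (fun x y : ↥B => ∑' n, lazyStep G n (x : V) (y : V)) - Matrix.of (fun x y : ↥B => conn G p (x : V) (y : V))).PosSemidef := by
  rw [Matrix.posSemidef_iff_dotProduct_mulVec]
  refine ⟨Matrix.IsHermitian.ext fun x y => ?_, fun w => ?_⟩
  · simp only [Matrix.sub_apply, Matrix.smul_apply, Matrix.of_apply, star_trivial, smul_eq_mul]
    rw [conn_comm G p (y : V) (x : V), tsum_congr fun n => lazyStep_comm G hG n (y : V) (x : V)]
  · -- the extension by zero of `w` as a finitely supported test function
    set e : V → ℝ := fun x => if hx : x ∈ B then w ⟨x, hx⟩ else 0 with he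
    set f : V →₀ ℝ := Finsupp.indicator B fun x hx => w ⟨x, hx⟩ with hf
    have hfB : f.support ⊆ B := Finsupp.support_indicator_subset _ _
    have hfx : ∀ x, f x = e x := fun x => by rw [hf, Finsupp.indicator_apply]
    have hT : twoPointForm G p f = w ⬝ᵥ (Matrix.of fun x y : ↥B => conn G p (x : V) (y : V)).mulVec w := by
      unfold twoPointForm
      rw [sum_support_eq_sum f hfB, ← sum_ext_mul_eq_dotProduct B _ w]
      simp only [hfx, he]
    have hq : 0 ≤ w ⬝ᵥ (Matrix.of fun x y : ↥B => ∑' n, lazyStep G n (x : V) (y : V)).mulVec w := by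
      rw [← sum_ext_mul_eq_dotProduct B (fun x y => ∑' n, lazyStep G n x y) w]
      exact green_quadratic_nonneg G hG hsum B e
    have hGr : greenForm G f = ENNReal.ofReal (w ⬝ᵥ (Matrix.of fun x y : ↥B => ∑' n, lazyStep G n (x : V) (y : V)).mulVec w) := by
      rw [greenForm_eq_ofReal G hG hsum f hfB, ← sum_ext_mul_eq_dotProduct B (fun x y => ∑' n, lazyStep G n x y) w]
      simp only [hfx, he]
    -- the operator infrared bound tested on `f`
    have hI := hO v₀ p hp f
    rw [hT, hGr, ← ENNReal.ofReal_mul hc, ENNReal.ofReal_le_ofReal_iff (mul_nonneg hc hq)] at hI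
    simp only [star_trivial, Matrix.sub_mulVec, dotProduct_sub, Matrix.smul_mulVec, dotProduct_smul, smul_eq_mul]
    linarith

/-- **`tr T_B³ ≤ c³ · tr G_B³`** — the finite shadow (p686689 `TraceShadow.trace_pow_three_mono_real`) applied to `0 ⪯ T_B ⪯ c·G_B`
(`posSemidef_connMatrix`, `posSemidef_green_sub_conn`). [cite: HornJohnson2013, Cor. 7.7.4] [cite: HeydenreichVanDerHofstad2017, §1.2] -/
theorem trace_connMatrix_pow_three_le [Countable V] {d : ℕ} (hG : G.IsRegularOfDegree d) (hsum : ∀ x y : V, Summable fun n => lazyStep G n x y)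
    {c : ℝ} (hc : 0 ≤ c) (hO : OperatorIRBound G (ENNReal.ofReal c)) {p : unitInterval} {v₀ : V} (hp : (p : ℝ) < criticalProb G v₀) (B : Finset V) :
    ((Matrix.of fun x y : ↥B => conn G p (x : V) (y : V)) ^ 3).trace ≤
      c ^ 3 * ((Matrix.of fun x y : ↥B => ∑' n, lazyStep G n (x : V) (y : V)) ^ 3).trace := by
  have h := TraceShadow.trace_pow_three_mono_real (posSemidef_connMatrix G p B) (posSemidef_green_sub_conn G hG hsum hc hO hp B)
  rwa [smul_pow, Matrix.trace_smul, smul_eq_mul] at h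

/-! ## §4 Diagonal entries of the cubes -/

omit [DecidableEq V] [G.LocallyFinite] in
/-- `(M³)(x, x) = Σ_{y,z} M(x,y) M(y,z) M(z,x)`. -/
theorem pow_three_apply_diag {ι : Type} [Fintype ι] [DecidableEq ι] (M : Matrix ι ι ℝ) (x : ι) :
    (M ^ 3) x x = ∑ y, ∑ z, M x y * M y z * M z x := by
  rw [pow_succ, pow_two, Matrix.mul_apply]
  simp only [Matrix.mul_apply, Finset.sum_mul]
  rw [Finset.sum_comm]

omit [G.LocallyFinite] in
/-- **`(T_B³)(x, x) = Σ_{y,z∈B} τ(x,y) τ(y,z) τ(z,x)`** — the restricted triangle diagram at `x`. -/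
theorem connMatrix_pow_three_diag (p : unitInterval) (B : Finset V) (x : ↥B) :
    ((Matrix.of fun a b : ↥B => conn G p (a : V) (b : V)) ^ 3) x x =
      ∑ y ∈ B, ∑ z ∈ B, conn G p (x : V) y * conn G p y z * conn G p z (x : V) := by
  rw [pow_three_apply_diag]
  simp only [Matrix.of_apply]
  have h1 : ∀ y : V, ∑ z : ↥B, conn G p (x : V) y * conn G p y (z : V) * conn G p (z : V) (x : V) =
      ∑ z ∈ B, conn G p (x : V) y * conn G p y z * conn G p z (x : V) :=
    fun y => Finset.sum_coe_sort B (fun z => conn G p (x : V) y * conn G p y z * conn G p z (x : V))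
  simp only [h1]
  exact Finset.sum_coe_sort B (fun y => ∑ z ∈ B, conn G p (x : V) y * conn G p y z * conn G p z (x : V))

/-- **`(G_B³)(x, x) ≤ G^L_3(x)`**: `Σ_{y,z∈B} 𝒢_L(x,y) 𝒢_L(y,z) 𝒢_L(z,x) ≤ (rwPolygon 3 G x).toReal` when `n ↦ p^L_n` is summable and the walk triangle at `x`
is finite (`green_cube_diag_le` transported to `ℝ`). [cite: HeydenreichVanDerHofstad2017, §5.2] -/
theorem greenMatrix_pow_three_diag_le (hsum : ∀ x y : V, Summable fun n => lazyStep G n x y) (B : Finset V) (x : ↥B)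
    (hfin : rwPolygon 3 G (x : V) ≠ ⊤) :
    ((Matrix.of fun a b : ↥B => ∑' n, lazyStep G n (a : V) (b : V)) ^ 3) x x ≤ (rwPolygon 3 G (x : V)).toReal := by
  rw [pow_three_apply_diag]
  simp only [Matrix.of_apply]
  have hg0 : ∀ a b : V, 0 ≤ ∑' n, lazyStep G n a b := fun a b => tsum_nonneg fun n => lazyStep_nonneg G n a b
  have hg : ∀ a b : V, ENNReal.ofReal (∑' n, lazyStep G n a b) = ∑' n, ENNReal.ofReal (lazyStep G n a b) :=
    fun a b => ENNReal.ofReal_tsum_of_nonneg (fun n => lazyStep_nonneg G n a b) (hsum a b)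
  have h1 : ∀ y : V, ∑ z : ↥B, (∑' n, lazyStep G n (x : V) y) * (∑' n, lazyStep G n y (z : V)) * (∑' n, lazyStep G n (z : V) (x : V)) =
      ∑ z ∈ B, (∑' n, lazyStep G n (x : V) y) * (∑' n, lazyStep G n y z) * (∑' n, lazyStep G n z (x : V)) :=
    fun y => Finset.sum_coe_sort B (fun z => (∑' n, lazyStep G n (x : V) y) * (∑' n, lazyStep G n y z) * (∑' n, lazyStep G n z (x : V)))
  simp only [h1]
  rw [Finset.sum_coe_sort B (fun y => ∑ z ∈ B, (∑' n, lazyStep G n (x : V) y) * (∑' n, lazyStep G n y z) * (∑' n, lazyStep G n z (x : V))),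
    ← ENNReal.ofReal_le_iff_le_toReal hfin, rwPolygon_three_eq,
    ENNReal.ofReal_sum_of_nonneg fun y _ => Finset.sum_nonneg fun z _ => mul_nonneg (mul_nonneg (hg0 _ _) (hg0 _ _)) (hg0 _ _)]
  refine le_trans (le_of_eq (Finset.sum_congr rfl fun y _ => ?_)) (green_cube_diag_le G B (x : V))
  rw [ENNReal.ofReal_sum_of_nonneg fun z _ => mul_nonneg (mul_nonneg (hg0 _ _) (hg0 _ _)) (hg0 _ _)]
  refine Finset.sum_congr rfl fun z _ => ?_
  rw [ENNReal.ofReal_mul (mul_nonneg (hg0 _ _) (hg0 _ _)), ENNReal.ofReal_mul (hg0 _ _), hg, hg, hg]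

end NcHaraSlade

end Grigorchuk

end Summit.CriticalPhenomena.PercolationContinuityZ3.Theorems.Transplant

end
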